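import Summits.CriticalPhenomena.PercolationContinuityZ3.Theorems.PercNearOneGluingNoHeavyLowerTailSahiOneStepCone
import HarnessLib

/-!
# One-step scheme: the `(2′)` inequality FAILS for the smallest non-matroidal first slot `x_a ∧ (x_b ∨ x_c)` — at EVERY interior density

Support file (prover prim-ineq-prove-3 gen 33; `--supports stmt-CriticalPhenomena-4575`; memo
`run/shared/lean/prim/prim-ineq-prove-3/FINDING-G33-KERNEL-FORMS.md` §7).  No definitions, no named facts, no sorries, no `native_decide`.

The `(2′)` half of the one-step scheme, `0 ≤ n(H; 1_A, 1_B)` (`SahiOneStep.osN`, i.e. `Cov(A,B) ≥ μ(Hᶜ)·Cov(A,B ∣ Hᶜ)`), is the route's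
hypothesis for HAMMING-THRESHOLD first slots `H = {N_F ≥ t}` (conjectured for all increasing `A, B`; many classes in the tree).  Gen 33 classified the first slots
`H` for which it can hold for all partners: exactly the complements of matroid independence complexes (memo §7; necessity is a theorem via Wagner's
Rayleigh ⟹ delta-matroid theorem).  This file puts the smallest witness of the necessity in the kernel: for three distinct coordinates and the increasing
event `H = {a ∈ ω} ∩ ({b ∈ ω} ∪ {c ∈ ω})` — whose complement `{∅-part} = {x_a = 0} ∪ {x_b = x_c = 0}` is the smallest non-matroidal down-set (maximal
faces of different sizes) — and the dictator partners `A = {b ∈ ω}`, `B = {c ∈ ω}`: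
* `osN_andOr_slot_eq` — the closed form `n(H; 1_A, 1_B) = −p_a(1−p_a)·p_b(1−p_b)·p_c(1−p_c)`;
* `osN_andOr_slot_neg` — hence `n < 0` whenever `0 < p_a, p_b, p_c < 1`: conditioning the product measure on `Hᶜ` makes the independent coordinates
  `b, c` POSITIVELY correlated, so the threshold (more generally: matroid) structure of the first slot cannot be dropped from `(2′)`.
-/

noncomputable section

namespace Summit.CriticalPhenomena.PercolationContinuityZ3.Theorems

namespace SahiOneStep

open MeasureTheory
open Literature.Probability.Percolation.DecisionTree (ind)
open Literature.Probability.LatticeModels (prodBernoulli prodBernoulli_real_subset prodBernoulli_real_setOf_mem)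
open scoped Classical

variable {ι : Type*} [Fintype ι] [DecidableEq ι]

omit [Fintype ι] in
/-- `{ω | i ∈ ω ∧ j ∈ ω} = {ω | {i,j} ⊆ ω}`. [folklore] -/
theorem setOf_mem_inter_setOf_mem_eq_subset_pair (i j : ι) :
    ({ω : Set ι | i ∈ ω} ∩ {ω | j ∈ ω}) = {ω | ((({i, j} : Finset ι)) : Set ι) ⊆ ω} := by
  ext ω
  simp only [Set.mem_inter_iff, Set.mem_setOf_eq, Finset.coe_insert, Finset.coe_singleton, Set.insert_subset_iff,
    Set.singleton_subset_iff]

omit [Fintype ι] in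
/-- `{ω | i ∈ ω} ∩ {ω | j ∈ ω} ∩ {ω | k ∈ ω} = {ω | {i,j,k} ⊆ ω}`. [folklore] -/
theorem setOf_mem_inter_inter_eq_subset_triple (i j k : ι) :
    ({ω : Set ι | i ∈ ω} ∩ {ω | j ∈ ω} ∩ {ω | k ∈ ω}) = {ω | ((({i, j, k} : Finset ι)) : Set ι) ⊆ ω} := by
  ext ω
  simp only [Set.mem_inter_iff, Set.mem_setOf_eq, Finset.coe_insert, Finset.coe_singleton, Set.insert_subset_iff,
    Set.singleton_subset_iff, and_assoc]

omit [Fintype ι] [DecidableEq ι] in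
/-- Two coordinates present: `μ{i ∈ ω ∧ j ∈ ω} = p_i p_j` (`i ≠ j`). [folklore] -/
theorem real_mem_inter_mem (p : ι → unitInterval) {i j : ι} (hij : i ≠ j) :
    (prodBernoulli p).real ({ω : Set ι | i ∈ ω} ∩ {ω | j ∈ ω}) = (p i : ℝ) * p j := by
  classical
  rw [setOf_mem_inter_setOf_mem_eq_subset_pair, prodBernoulli_real_subset, Finset.prod_pair hij]

omit [Fintype ι] [DecidableEq ι] in
/-- Three coordinates present: `μ{i, j, k ∈ ω} = p_i p_j p_k` (distinct). [folklore] -/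
theorem real_mem_inter_mem_inter_mem (p : ι → unitInterval) {i j k : ι} (hij : i ≠ j) (hik : i ≠ k) (hjk : j ≠ k) :
    (prodBernoulli p).real ({ω : Set ι | i ∈ ω} ∩ {ω | j ∈ ω} ∩ {ω | k ∈ ω}) = (p i : ℝ) * p j * p k := by
  classical
  rw [setOf_mem_inter_inter_eq_subset_triple, prodBernoulli_real_subset,
    Finset.prod_insert (by simp [hij, hik]), Finset.prod_pair hjk, mul_assoc]

omit [DecidableEq ι] in
/-- **Closed form of `n` for the AND–OR slot against the two inner dictators.**  For distinct `a, b, c` and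
`H = {a ∈ ω} ∩ ({b ∈ ω} ∪ {c ∈ ω})`, `A = {b ∈ ω}`, `B = {c ∈ ω}`:
`n(H; 1_A, 1_B) = −p_a(1−p_a)·p_b(1−p_b)·p_c(1−p_c)`. [this work] -/
theorem osN_andOr_slot_eq (p : ι → unitInterval) {a b c : ι} (hab : a ≠ b) (hac : a ≠ c) (hbc : b ≠ c) :
    osN p ({ω : Set ι | a ∈ ω} ∩ ({ω | b ∈ ω} ∪ {ω | c ∈ ω})) (ind {ω : Set ι | b ∈ ω}) (ind {ω : Set ι | c ∈ ω}) =
      -((p a : ℝ) * (1 - p a) * ((p b : ℝ) * (1 - p b)) * ((p c : ℝ) * (1 - p c))) := by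
  classical
  set H : Set (Set ι) := {ω : Set ι | a ∈ ω} ∩ ({ω | b ∈ ω} ∪ {ω | c ∈ ω}) with hH
  -- the intersections of `H` with the dictators are monomial events
  have hHA : H ∩ {ω : Set ι | b ∈ ω} = {ω : Set ι | a ∈ ω} ∩ {ω | b ∈ ω} := by
    ext ω; simp only [hH, Set.mem_inter_iff, Set.mem_union, Set.mem_setOf_eq]; tauto
  have hHB : H ∩ {ω : Set ι | c ∈ ω} = {ω : Set ι | a ∈ ω} ∩ {ω | c ∈ ω} := by
    ext ω; simp only [hH, Set.mem_inter_iff, Set.mem_union, Set.mem_setOf_eq]; tauto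
  -- `H` itself is the union of two monomial events
  have hHU : H = ({ω : Set ι | a ∈ ω} ∩ {ω | b ∈ ω}) ∪ ({ω : Set ι | a ∈ ω} ∩ {ω | c ∈ ω}) := by
    ext ω; simp only [hH, Set.mem_inter_iff, Set.mem_union, Set.mem_setOf_eq]; tauto
  have hHI : ({ω : Set ι | a ∈ ω} ∩ {ω | b ∈ ω}) ∩ ({ω : Set ι | a ∈ ω} ∩ {ω | c ∈ ω})
      = {ω : Set ι | a ∈ ω} ∩ {ω | b ∈ ω} ∩ {ω | c ∈ ω} := by
    ext ω; simp only [Set.mem_inter_iff, Set.mem_setOf_eq]; tauto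
  have hmeasAC : MeasurableSet ({ω : Set ι | a ∈ ω} ∩ {ω | c ∈ ω}) := (measurableSet_mem a).inter (measurableSet_mem c)
  have hrealH : (prodBernoulli p).real H = (p a : ℝ) * p b + (p a : ℝ) * p c - (p a : ℝ) * p b * p c := by
    have h := measureReal_union_add_inter (μ := prodBernoulli p) (s := {ω : Set ι | a ∈ ω} ∩ {ω | b ∈ ω}) hmeasAC
    rw [← hHU, hHI, real_mem_inter_mem p hab, real_mem_inter_mem p hac, real_mem_inter_mem_inter_mem p hab hac hbc] at h
    linarith
  rw [osN_ind_ind, hHA, hHB, hrealH, real_mem_inter_mem p hab, real_mem_inter_mem p hac,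
    real_mem_inter_mem_inter_mem p hab hac hbc, prodBernoulli_real_setOf_mem, prodBernoulli_real_setOf_mem]
  ring

omit [DecidableEq ι] in
/-- **`(2′)` fails for the AND–OR first slot.**  For distinct coordinates `a, b, c` with interior densities, `H = {a ∈ ω} ∩ ({b ∈ ω} ∪ {c ∈ ω})` and the
dictators `A = {b ∈ ω}`, `B = {c ∈ ω}`: `n(H; 1_A, 1_B) < 0`, i.e. `Cov(A,B) < μ(Hᶜ)·Cov(A,B ∣ Hᶜ)`.  The complement of `H` is the smallest down-set that is
not a matroid complex; the threshold (matroid) structure of the first slot is therefore essential in the one-step `(2′)` hypothesis. [this work] -/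
theorem osN_andOr_slot_neg (p : ι → unitInterval) {a b c : ι} (hab : a ≠ b) (hac : a ≠ c) (hbc : b ≠ c)
    (ha0 : 0 < (p a : ℝ)) (ha1 : (p a : ℝ) < 1) (hb0 : 0 < (p b : ℝ)) (hb1 : (p b : ℝ) < 1) (hc0 : 0 < (p c : ℝ)) (hc1 : (p c : ℝ) < 1) :
    osN p ({ω : Set ι | a ∈ ω} ∩ ({ω | b ∈ ω} ∪ {ω | c ∈ ω})) (ind {ω : Set ι | b ∈ ω}) (ind {ω : Set ι | c ∈ ω}) < 0 := by
  rw [osN_andOr_slot_eq p hab hac hbc, neg_lt_zero]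
  have h1 : 0 < (p a : ℝ) * (1 - p a) := mul_pos ha0 (by linarith)
  have h2 : 0 < (p b : ℝ) * (1 - p b) := mul_pos hb0 (by linarith)
  have h3 : 0 < (p c : ℝ) * (1 - p c) := mul_pos hc0 (by linarith)
  positivity

end SahiOneStep

end Summit.CriticalPhenomena.PercolationContinuityZ3.Theorems
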